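import Summits.AnomalousDissipation.AnomalousDissipation.Theorems.ImpulseGridBoundedEnergyNoLeakGridHardnessLH
import HarnessLib

/-!
# The `Φ ≡ 1` slice of the residual UEDF is zero-momentum saturation, for EVERY drift
# (crux stmt-AnomalousDissipation-14350, line `Sketch`, lead c2)

Support file for the crux `Summit.AnomalousDissipation.AnomalousDissipation.Theses.ImpulseGrid.BoundedEnergyNoLeakGrid`
(item stmt-AnomalousDissipation-14350).  For a columnar pattern `G` (smooth, `x₀`-invariant, mean zero) write

* `DriftSat G c`  — there are `ν_j → 0⁺`, data with drift `∫ u₀ j = c e₀` and global Leray–Hopf solutions of `NS_{ν_j}(G)`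
  with `j`-uniformly bounded mean energy (the conclusion of UEDF at the design `(1, G, c)`);
* `ZMSat G`       — the same with ZERO-MOMENTUM square-integrable data (`Correlation.BoundedEnergyFamilyZM` for the
  force `G`, with `L²` data).

Galilean covariance of global Leray–Hopf solutions (`Torus.IsGlobalLerayHopf.galilean_unboost_update`) in both
directions (`V = c e₀` and `V = −c e₀`; the swept force `G(· ± [t c e₀])` is `G`) gives

* `zeroMomentumSat_of_driftSat` : `DriftSat G c → ZMSat G` (any `c`),
* `driftSat_of_zeroMomentumSat` : `ZMSat G → DriftSat G c` (any `c`),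
* `driftSat_iff_zeroMomentumSat`, `driftSat_iff_driftSat` : so `DriftSat G c` does not depend on `c > 0` at all.

So at `Φ ≡ 1` the residual of stmt-14350 is EXACTLY zero-momentum turbulent saturation for columnar forces (Doering–Foias
2002 §3, `Re ~ Gr^{1/2}`), uniformly in the pattern and independently of the drift; the drift is a pure Galilean
artefact there (Frisch 1995 §2.2).  (For `Φ ≢ 1` the force is time dependent in the moving frame and no such
reduction is claimed.)  No definitions: both statements are written out.
-/

-- `Summit.<Summit>.<Problem>` is the tree's mandated summit-side namespace (CONVENTIONS §2); for this
-- single-conjunct summit the two coincide, so the duplicate is deliberate.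
set_option linter.dupNamespace false

noncomputable section

open MeasureTheory Filter Set Function
open scoped InnerProductSpace RealInnerProductSpace
open Literature.Analysis.FunctionSpaces Literature.Analysis.FunctionSpaces.Torus
open Literature.Analysis.FluidPDE Literature.Analysis.FluidPDE.Torus

namespace Summit.AnomalousDissipation.AnomalousDissipation.Theorems

namespace BoundedEnergyNoLeakGridDriftSlice

local notation "𝕋³" => UnitAddTorus (Fin 3)
local notation "E³" => EuclideanSpace ℝ (Fin 3)

/-- Along the columns every swept pattern is the pattern: `G (y + [t (a e₀)]) = G y` for an `x₀`-invariant `G`. [folklore] -/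
theorem apply_add_proj_smul_smul_single_zero {G : 𝕋³ → E³}
    (hGinv : ∀ (s : UnitAddCircle) x, G (x + Pi.single (0 : Fin 3) s) = G x) (a t : ℝ) (y : 𝕋³) :
    G (y + proj (t • (a • EuclideanSpace.single (0 : Fin 3) (1 : ℝ)))) = G y := by
  rw [smul_smul, proj_smul_single, hGinv]

/-- **One Galilean step.**  A global Leray–Hopf family under a columnar force `G` with `L²` data of common momentum
`m e₀… = M` (any fixed vector `M`) and mean energies `≤ E`, boosted by the constant velocity `a e₀`, is a global
Leray–Hopf family under `G` with data of momentum `M − a e₀` and mean energies `≤ 2E + 2a²`. [folklore] -/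
theorem boost_family {G : 𝕋³ → E³} (hGs : IsSmooth G)
    (hGinv : ∀ (s : UnitAddCircle) x, G (x + Pi.single (0 : Fin 3) s) = G x) (hGmean : HasZeroMean G)
    {ν : ℕ → ℝ} {u₀ : ℕ → 𝕋³ → E³} {u : ℕ → ℝ → 𝕋³ → E³} (hν : ∀ j, 0 < ν j)
    (hLH : ∀ j, IsGlobalLerayHopf (ν j) (fun _ => G) (u₀ j) (u j)) (hL2 : ∀ j, MemLp (u₀ j) 2 volume)
    {M : E³} (hdat : ∀ j, ∫ x, u₀ j x = M) {E : ℝ} (hE : ∀ j, meanEnergy (u j) ≤ E) (a : ℝ) :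
    ∃ (v₀ : ℕ → 𝕋³ → E³) (v : ℕ → ℝ → 𝕋³ → E³),
      (∀ j, IsGlobalLerayHopf (ν j) (fun _ => G) (v₀ j) (v j)) ∧ (∀ j, MemLp (v₀ j) 2 volume) ∧
      (∀ j, ∫ x, v₀ j x = M - a • EuclideanSpace.single (0 : Fin 3) (1 : ℝ)) ∧
      (∀ j, meanEnergy (v j) ≤ 2 * E + 2 * a ^ 2) := by
  set V : E³ := a • EuclideanSpace.single (0 : Fin 3) (1 : ℝ) with hV
  have hswept : (fun (t : ℝ) (y : 𝕋³) => G (y + proj (t • V))) = fun _ => G := by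
    funext t y; rw [hV]; exact apply_add_proj_smul_smul_single_zero hGinv a t y
  have hVn : ‖V‖ ^ 2 = a ^ 2 := by
    rw [hV, norm_smul, Real.norm_eq_abs]; simp [sq_abs]
  refine ⟨fun j y => u₀ j y - V, fun j t y => update (u j) 0 (u₀ j) t (y + proj (t • V)) - V,
    fun j => ?_, fun j => (hL2 j).sub (memLp_const V), fun j => ?_, fun j => ?_⟩
  · have h := (hLH j).galilean_unboost_update hGs hGmean (hL2 j) V
    rwa [hswept] at h
  · show ∫ y, (u₀ j y - V) = M - V
    rw [integral_sub ((hL2 j).integrable one_le_two) (integrable_const V), integral_const, probReal_univ, one_smul,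
      hdat j]
  · show meanEnergy (fun t y => update (u j) 0 (u₀ j) t (y + proj (t • V)) - V) ≤ 2 * E + 2 * a ^ 2
    have hvw : ∀ t, 0 < t → (fun t y => update (u j) 0 (u₀ j) t (y + proj (t • V)) - V) t =
        (fun t y => u j t (y + proj (t • V)) - V) t := fun t ht => by
      funext y; simp only [update_of_ne ht.ne']
    rw [meanEnergy_congr_of_eqOn_Ioi hvw]
    have h := (hLH j).meanEnergy_galilean_le (hν j) hGs hGmean V
    rw [hVn] at h
    linarith [hE j]

end BoundedEnergyNoLeakGridDriftSlice

open BoundedEnergyNoLeakGridDriftSlice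

/-- **Drift saturation ⇒ zero-momentum saturation** for a columnar pattern and a NON-ZERO drift `c` (then the data are
integrable, having the non-zero integral `c e₀`, hence honest `L²` fields): boost by `c e₀`. [folklore] -/
theorem zeroMomentumSat_of_driftSat {G : UnitAddTorus (Fin 3) → EuclideanSpace ℝ (Fin 3)} (hGs : IsSmooth G)
    (hGinv : ∀ (s : UnitAddCircle) x, G (x + Pi.single (0 : Fin 3) s) = G x) (hGmean : HasZeroMean G) {c : ℝ}
    (hc : c ≠ 0)
    (h : ∃ (ν : ℕ → ℝ) (u₀ : ℕ → UnitAddTorus (Fin 3) → EuclideanSpace ℝ (Fin 3))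
        (u : ℕ → ℝ → UnitAddTorus (Fin 3) → EuclideanSpace ℝ (Fin 3)),
      (∀ j, 0 < ν j) ∧ Tendsto ν atTop (nhds 0) ∧ (∀ j, IsGlobalLerayHopf (ν j) (fun _ => G) (u₀ j) (u j)) ∧
      (∀ j, ∫ x, u₀ j x = c • EuclideanSpace.single 0 1) ∧ ∃ E : ℝ, ∀ j, meanEnergy (u j) ≤ E) :
    ∃ (ν : ℕ → ℝ) (v₀ : ℕ → UnitAddTorus (Fin 3) → EuclideanSpace ℝ (Fin 3))
        (v : ℕ → ℝ → UnitAddTorus (Fin 3) → EuclideanSpace ℝ (Fin 3)),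
      (∀ j, 0 < ν j) ∧ Tendsto ν atTop (nhds 0) ∧ (∀ j, MemLp (v₀ j) 2 volume) ∧ (∀ j, HasZeroMean (v₀ j)) ∧
      (∀ j, IsGlobalLerayHopf (ν j) (fun _ => G) (v₀ j) (v j)) ∧ ∃ E : ℝ, ∀ j, meanEnergy (v j) ≤ E := by
  obtain ⟨ν, u₀, u, hν, hν0, hLH, hdat, E, hE⟩ := h
  have hint : ∀ j, Integrable (u₀ j) volume := fun j => by
    by_contra h
    have h0 := integral_undef h
    rw [hdat j] at h0
    have := congrArg (fun w : EuclideanSpace ℝ (Fin 3) => w 0) h0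
    simp [hc] at this
  have hL2 : ∀ j, MemLp (u₀ j) 2 volume := fun j => (hLH j).memLp_two_datum (hint j).aestronglyMeasurable
  obtain ⟨v₀, v, hvLH, hvL2, hvdat, hvE⟩ := boost_family hGs hGinv hGmean hν hLH hL2 hdat hE c
  refine ⟨ν, v₀, v, hν, hν0, hvL2, fun j => ?_, hvLH, ⟨2 * E + 2 * c ^ 2, hvE⟩⟩
  show ∫ x, v₀ j x = 0
  rw [hvdat j, sub_self]

/-- **Zero-momentum saturation ⇒ drift saturation** for a columnar pattern and ANY drift `c`: boost by `−c e₀`. [folklore] -/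
theorem driftSat_of_zeroMomentumSat {G : UnitAddTorus (Fin 3) → EuclideanSpace ℝ (Fin 3)} (hGs : IsSmooth G)
    (hGinv : ∀ (s : UnitAddCircle) x, G (x + Pi.single (0 : Fin 3) s) = G x) (hGmean : HasZeroMean G) (c : ℝ)
    (h : ∃ (ν : ℕ → ℝ) (v₀ : ℕ → UnitAddTorus (Fin 3) → EuclideanSpace ℝ (Fin 3))
        (v : ℕ → ℝ → UnitAddTorus (Fin 3) → EuclideanSpace ℝ (Fin 3)),
      (∀ j, 0 < ν j) ∧ Tendsto ν atTop (nhds 0) ∧ (∀ j, MemLp (v₀ j) 2 volume) ∧ (∀ j, HasZeroMean (v₀ j)) ∧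
      (∀ j, IsGlobalLerayHopf (ν j) (fun _ => G) (v₀ j) (v j)) ∧ ∃ E : ℝ, ∀ j, meanEnergy (v j) ≤ E) :
    ∃ (ν : ℕ → ℝ) (u₀ : ℕ → UnitAddTorus (Fin 3) → EuclideanSpace ℝ (Fin 3))
        (u : ℕ → ℝ → UnitAddTorus (Fin 3) → EuclideanSpace ℝ (Fin 3)),
      (∀ j, 0 < ν j) ∧ Tendsto ν atTop (nhds 0) ∧ (∀ j, IsGlobalLerayHopf (ν j) (fun _ => G) (u₀ j) (u j)) ∧
      (∀ j, ∫ x, u₀ j x = c • EuclideanSpace.single 0 1) ∧ ∃ E : ℝ, ∀ j, meanEnergy (u j) ≤ E := by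
  obtain ⟨ν, v₀, v, hν, hν0, hL2, hzm, hLH, E, hE⟩ := h
  obtain ⟨u₀, u, huLH, -, hudat, huE⟩ := boost_family hGs hGinv hGmean hν hLH hL2 (M := 0) hzm hE (-c)
  refine ⟨ν, u₀, u, hν, hν0, huLH, fun j => ?_, ⟨2 * E + 2 * (-c) ^ 2, huE⟩⟩
  rw [hudat j, neg_smul, zero_sub, neg_neg]

/-- **At `Φ ≡ 1` the residual is zero-momentum saturation**, for every non-zero drift: for a columnar pattern `G`,
`DriftSat G c ↔ ZMSat G` (`c ≠ 0`). [folklore] -/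
theorem driftSat_iff_zeroMomentumSat {G : UnitAddTorus (Fin 3) → EuclideanSpace ℝ (Fin 3)} (hGs : IsSmooth G)
    (hGinv : ∀ (s : UnitAddCircle) x, G (x + Pi.single (0 : Fin 3) s) = G x) (hGmean : HasZeroMean G) {c : ℝ}
    (hc : c ≠ 0) :
    (∃ (ν : ℕ → ℝ) (u₀ : ℕ → UnitAddTorus (Fin 3) → EuclideanSpace ℝ (Fin 3))
        (u : ℕ → ℝ → UnitAddTorus (Fin 3) → EuclideanSpace ℝ (Fin 3)),
      (∀ j, 0 < ν j) ∧ Tendsto ν atTop (nhds 0) ∧ (∀ j, IsGlobalLerayHopf (ν j) (fun _ => G) (u₀ j) (u j)) ∧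
      (∀ j, ∫ x, u₀ j x = c • EuclideanSpace.single 0 1) ∧ ∃ E : ℝ, ∀ j, meanEnergy (u j) ≤ E) ↔
    (∃ (ν : ℕ → ℝ) (v₀ : ℕ → UnitAddTorus (Fin 3) → EuclideanSpace ℝ (Fin 3))
        (v : ℕ → ℝ → UnitAddTorus (Fin 3) → EuclideanSpace ℝ (Fin 3)),
      (∀ j, 0 < ν j) ∧ Tendsto ν atTop (nhds 0) ∧ (∀ j, MemLp (v₀ j) 2 volume) ∧ (∀ j, HasZeroMean (v₀ j)) ∧
      (∀ j, IsGlobalLerayHopf (ν j) (fun _ => G) (v₀ j) (v j)) ∧ ∃ E : ℝ, ∀ j, meanEnergy (v j) ≤ E) :=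
  ⟨zeroMomentumSat_of_driftSat hGs hGinv hGmean hc, driftSat_of_zeroMomentumSat hGs hGinv hGmean c⟩

/-- **The drift magnitude is irrelevant at `Φ ≡ 1`**: `DriftSat G c → DriftSat G c'` for `c ≠ 0` and any `c'`. [folklore] -/
theorem driftSat_of_driftSat {G : UnitAddTorus (Fin 3) → EuclideanSpace ℝ (Fin 3)} (hGs : IsSmooth G)
    (hGinv : ∀ (s : UnitAddCircle) x, G (x + Pi.single (0 : Fin 3) s) = G x) (hGmean : HasZeroMean G) {c : ℝ}
    (hc : c ≠ 0) (c' : ℝ)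
    (h : ∃ (ν : ℕ → ℝ) (u₀ : ℕ → UnitAddTorus (Fin 3) → EuclideanSpace ℝ (Fin 3))
        (u : ℕ → ℝ → UnitAddTorus (Fin 3) → EuclideanSpace ℝ (Fin 3)),
      (∀ j, 0 < ν j) ∧ Tendsto ν atTop (nhds 0) ∧ (∀ j, IsGlobalLerayHopf (ν j) (fun _ => G) (u₀ j) (u j)) ∧
      (∀ j, ∫ x, u₀ j x = c • EuclideanSpace.single 0 1) ∧ ∃ E : ℝ, ∀ j, meanEnergy (u j) ≤ E) :
    ∃ (ν : ℕ → ℝ) (u₀ : ℕ → UnitAddTorus (Fin 3) → EuclideanSpace ℝ (Fin 3))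
        (u : ℕ → ℝ → UnitAddTorus (Fin 3) → EuclideanSpace ℝ (Fin 3)),
      (∀ j, 0 < ν j) ∧ Tendsto ν atTop (nhds 0) ∧ (∀ j, IsGlobalLerayHopf (ν j) (fun _ => G) (u₀ j) (u j)) ∧
      (∀ j, ∫ x, u₀ j x = c' • EuclideanSpace.single 0 1) ∧ ∃ E : ℝ, ∀ j, meanEnergy (u j) ≤ E :=
  driftSat_of_zeroMomentumSat hGs hGinv hGmean c' (zeroMomentumSat_of_driftSat hGs hGinv hGmean hc h)

/-- **Registered form** (sub-goal `driftSliceZeroMomentum` of crux stmt-AnomalousDissipation-14350): at `Φ ≡ 1` and non-zero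
drift, uniform-energy drift families for a columnar pattern exist iff zero-momentum ones do. [folklore] -/
theorem driftSliceZeroMomentum :
    ∀ (G : UnitAddTorus (Fin 3) → EuclideanSpace ℝ (Fin 3)) (c : ℝ), IsSmooth G → (∀ (s : UnitAddCircle) x, G (x + Pi.single (0 : Fin 3) s) = G x) → HasZeroMean G → c ≠ 0 → ((∃ (ν : ℕ → ℝ) (u₀ : ℕ → UnitAddTorus (Fin 3) → EuclideanSpace ℝ (Fin 3)) (u : ℕ → ℝ → UnitAddTorus (Fin 3) → EuclideanSpace ℝ (Fin 3)), (∀ j, 0 < ν j) ∧ Filter.Tendsto ν Filter.atTop (nhds 0) ∧ (∀ j, IsGlobalLerayHopf (ν j) (fun _ => G) (u₀ j) (u j)) ∧ (∀ j, ∫ x, u₀ j x = c • EuclideanSpace.single 0 1) ∧ ∃ E : ℝ, ∀ j, meanEnergy (u j) ≤ E) ↔ (∃ (ν : ℕ → ℝ) (v₀ : ℕ → UnitAddTorus (Fin 3) → EuclideanSpace ℝ (Fin 3)) (v : ℕ → ℝ → UnitAddTorus (Fin 3) → EuclideanSpace ℝ (Fin 3)), (∀ j, 0 < ν j) ∧ Filter.Tendsto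 ν Filter.atTop (nhds 0) ∧ (∀ j, MeasureTheory.MemLp (v₀ j) 2 MeasureTheory.volume) ∧ (∀ j, HasZeroMean (v₀ j)) ∧ (∀ j, IsGlobalLerayHopf (ν j) (fun _ => G) (v₀ j) (v j)) ∧ ∃ E : ℝ, ∀ j, meanEnergy (v j) ≤ E)) :=
  fun _ _ hGs hGinv hGmean hc => driftSat_iff_zeroMomentumSat hGs hGinv hGmean hc

end Summit.AnomalousDissipation.AnomalousDissipation.Theorems
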